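import Summits.BirchSwinnertonDyer.BirchSwinnertonDyer.Theses.QuadraticBranchSignedControl
import Summits.BirchSwinnertonDyer.BirchSwinnertonDyer.Theorems.QuadraticBranchSignedControlEtaDescentFrame
import Summits.BirchSwinnertonDyer.BirchSwinnertonDyer.Theorems.QuadraticBranchSignedControlEtaTransportPlus
import Summits.BirchSwinnertonDyer.BirchSwinnertonDyer.Theorems.QuadraticBranchSignedControlPlusEtaNodeCurrency
import Summits.BirchSwinnertonDyer.BirchSwinnertonDyer.Theorems.QuadraticBranchSignedControlPlusLowerInclusionUnitCoeffCertificates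
import Summits.BirchSwinnertonDyer.BirchSwinnertonDyer.Theorems.QuadraticBranchSignedControlPlusLowerInclusionSurjBranchOfEta
import HarnessLib

/-!
# Route `QuadraticBranchSignedControl` (rung K8, cell `bsd-potss`), crux `PlusEtaLowerInclusion`
# (stmt-BirchSwinnertonDyer-19601): the η-package with its DESCENT FRAMES DISCHARGED, and the
# per-pair CERTIFICATE ROAD for (E⁺_η) over Kobayashi's named theorems alone

WHAT. With the ∀-form frame `EtaDescentFrame` PROVED (`etaDescentFrame_proof`, item 19611, p446xxx of
seat k8eta-c2; model-change helper p446586 of this seat) and the ∃-form frame PROVED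
(`etaDecomposition`, seat k8q-c3, p442838), every frame hypothesis (`hdec` / `hdecA` / `hdecE`) of the
K8 even-main-conjecture block disappears. THIS FILE records the resulting statements, in which the
ONLY remaining hypotheses are Kobayashi's published theorems (held in the route as the aliases
19603/19604/19608/19612/19613) and, per pair, two computable unit-coefficient certificates:
* §1 the three `F`-form items versus their print-currency `η`-nodes — 19242 `PlusLowerInclusionSurjBranch`
  ⟺ 19601 `PlusEtaLowerInclusion` granted Thm. 1.2 + Thm. 2.2 at `η`; 19114 `PlusMainConjectureBranch`
  ⟺ «(C1⁺_η) at every Gss2 pair» and 19243 ⟺ 19606 granted Thm. 1.2; (RK⁺) 19241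
  `PlusKatoDivisibilityBranch` from Thm. 4.1 at `η` + Thm. 2.2 at `η` + Thm. 1.2 ALONE (glue 19614 fed
  with the proved frame);
* §2 the per-pair road to the crux node (E⁺_η) `QuadraticBranchPlusEtaLowerInclusionAt V p` (and to
  the full (C1⁺_η) at the pair) on a tower-onto pair: Kobayashi's Thm. 1.2, Thm. 1.3 (= 4.1 at
  `η = 1`), Thm. 2.2 at `η`, Thm. 4.1 at `η` + the two UNIT-COEFFICIENT CERTIFICATES of seat k8q-c2's
  `λ`-squeeze (`coeff_{rank V(ℚ)} L_p⁺(V,T) ∈ ℤ_pˣ`, `coeff_{rank V^{(p*)}(ℚ)} L_p⁺(V,η,T) ∈ ℤ_pˣ`;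
  decidable per pair by Pollack's algorithm / PARI `ellpadiclambdamu`) — k8q-c2's `F`-currency road
  (p429451) followed by k8q-c3's unconditional transport `etaTransportPlus`, with (RK⁺) at the pair
  now supplied by §1; and the route-level bill «19601 ⟸ facts + certificates on the certificate rows +
  (E⁺_η) on the displayed residual rows».

HONEST FRAMING (cell `bsd-potss`, run/shared/lean/pub/bsd-potss/; FULL-BSD rank ≤ 1 programme):
TOOL / BOOKKEEPING THEOREMS ONLY. Every statement here is CONDITIONAL on named Literature facts in
hypothesis position (Kobayashi 2003 Thm. 1.2 / 1.3 / 2.2 / 4.1 — deep theorems, not proved in the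
tree) and, in §2, on per-pair certificates NOT supplied here for any pair. The crux 19601 (= Kato's
lower inclusion for the additive twist `V ⊗ χ_{p*}` on the `η`-component) is OPEN class-wide and is
NOT closed; the certificate road says nothing on rows where a certificate fails (`p ∣` the leading
coefficient, `λ`-jumps, `μ > 0`). Nothing is booked; `BSD(W, p)` is claimed for no pair; no definition,
no named fact, no `sorry`, axioms standard. Seat `bsd-potss-k8eta-c1` (prover), g0;
`--supports stmt-BirchSwinnertonDyer-19601`.

References: [Kobayashi2003] Thm. 1.2, Thm. 1.3 (p. 2), Thm. 2.2 (p. 5), §3 + (3.4)/(3.6) (pp. 5–7),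
§4 Even main conjecture + Thm. 4.1 (p. 8); [Kato2004Asterisque] Thm. 12.5, Conj. 12.10;
[GreenbergLNM1716] §1, §3; [Pollack2003] Thm. 5.6, Prop. 6.18; [PollackRubin2004] p. 448.
-/

set_option autoImplicit false
set_option linter.dupNamespace false

noncomputable section

open scoped Classical

open CongruenceSubgroup Field WeierstrassCurve
open Literature.NumberTheory.EllipticCurves
open Literature.NumberTheory.EllipticCurves.ModularForms
open Literature.NumberTheory.GaloisRepresentations
open Summit.BirchSwinnertonDyer.Rank1Residual.Additive
open Summit.BirchSwinnertonDyer.Rank1Residual.Additive.SignedTwist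
open Summit.BirchSwinnertonDyer.BirchSwinnertonDyer.Theses.QuadraticBranchSignedControl

namespace Summit.BirchSwinnertonDyer.BirchSwinnertonDyer.Theorems

/-! ## §1 The η-package with the frames discharged -/

/-- **19242 ⟺ 19601**: `PlusLowerInclusionSurjBranch` (the Eisenstein inclusion (E⁺) in `F`-currency on
the onto-tower rows) is EQUIVALENT to `PlusEtaLowerInclusion` ((E⁺_η) in print currency), granted ONLY
Kobayashi's Thm. 1.2 and Thm. 2.2 at `η` (named facts, hypothesis position) — seat k8q-c2's
`plusLowerInclusionSurjBranch_iff_forall_etaLowerInclusionAt_of_frames` with BOTH frames discharged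
(`etaDescentFrame_proof`, `etaDecomposition`). CONDITIONAL on the two facts; closes nothing.
[cite: Kobayashi2003, Thm. 1.2 (p. 2), Thm. 2.2 (p. 5), §4 Even main conjecture (p. 8)] -/
theorem plusLowerInclusionSurjBranch_iff_plusEtaLowerInclusion
    (h12 : Kobayashi2003.thm12_signedSelmerDual_finite_torsion)
    (h22 : Kobayashi2003.thm22_etaSignedSelmerDual_finite_torsion) :
    PlusLowerInclusionSurjBranch ↔ PlusEtaLowerInclusion :=
  plusLowerInclusionSurjBranch_iff_forall_etaLowerInclusionAt_of_frames h12 h22 etaDescentFrame_proof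
    etaDecomposition

/-- **19114 ⟺ «(C1⁺_η) at every Gss2 pair»**: `PlusMainConjectureBranch` is equivalent to Kobayashi's
even main conjecture at `η` VERBATIM (`QuadraticBranchPlusEtaMainConjectureAt V p`) for every good
`a_p = 0` curve, `p ≥ 5`, granted ONLY Thm. 1.2 — k8q-c2's seam with both frames discharged.
CONDITIONAL on the fact; closes nothing. [cite: Kobayashi2003, Thm. 1.2 (p. 2), §4 Even main conjecture (p. 8)] -/
theorem plusMainConjectureBranch_iff_forall_etaMainConjectureAt
    (h12 : Kobayashi2003.thm12_signedSelmerDual_finite_torsion) :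
    PlusMainConjectureBranch ↔
      ∀ (V : WeierstrassCurve ℚ) [V.IsElliptic] [V.IsGloballyMinimal] (p : ℕ) [Fact p.Prime],
        5 ≤ p → V.HasGoodReductionAtPrime p → V.frobeniusTrace p = 0 →
        QuadraticBranchPlusEtaMainConjectureAt V p :=
  plusMainConjectureBranch_iff_forall_etaMainConjectureAt_of_frames h12 etaDescentFrame_proof
    etaDecomposition

/-- **19243 ⟺ 19606**: `PlusMainConjectureNonsurjBranch` (the non-onto rows in `F`-currency) is
equivalent to `PlusEtaMainConjectureNonsurj` (print currency), granted ONLY Thm. 1.2 — k8q-c2's seam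
with both frames discharged. CONDITIONAL on the fact; closes nothing.
[cite: Kobayashi2003, Thm. 1.2 (p. 2), §4 Even main conjecture (p. 8)] [cite: PollackRubin2004, p. 448 (CM rows; remark)] -/
theorem plusMainConjectureNonsurjBranch_iff_plusEtaMainConjectureNonsurj
    (h12 : Kobayashi2003.thm12_signedSelmerDual_finite_torsion) :
    PlusMainConjectureNonsurjBranch ↔ PlusEtaMainConjectureNonsurj :=
  plusMainConjectureNonsurjBranch_iff_forall_etaMainConjectureAt_of_frames h12 etaDescentFrame_proof
    etaDecomposition

/-- **(RK⁺) 19241 `PlusKatoDivisibilityBranch` from Kobayashi's theorems ALONE**: Thm. 4.1 at `η`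
(plus `η`-divisibility), Thm. 2.2 at `η` and Thm. 1.2 (named facts, hypothesis position) — glue 19614
(`plusKatoDivisibilityBranchOfNamedFacts_proof`) fed with the PROVED frame. A CONDITIONAL RESULT on
three published theorems; the item is settled-by-citation, not proved in-tree.
[cite: Kobayashi2003, Thm. 4.1 (p. 8), Thm. 2.2 (p. 5), Thm. 1.2 (p. 2)] [cite: Kato2004Asterisque, Thm. 12.5] -/
theorem plusKatoDivisibilityBranch_of_namedFacts
    (h41 : Kobayashi2003.thm41_plusEtaCharIdeal_dvd)
    (h22 : Kobayashi2003.thm22_etaSignedSelmerDual_finite_torsion)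
    (h12 : Kobayashi2003.thm12_signedSelmerDual_finite_torsion) :
    PlusKatoDivisibilityBranch :=
  plusKatoDivisibilityBranchOfNamedFacts_proof etaDescentFrame_proof h41 h22 h12

/-! ## §2 The per-pair certificate road to (E⁺_η) over the named facts -/

section Certificates

variable {V : WeierstrassCurve ℚ} [V.IsElliptic] [V.IsGloballyMinimal] {p : ℕ} [Fact p.Prime]

/-- **(C1⁺_η) — Kobayashi's even main conjecture at `η` VERBATIM — AT A TOWER-ONTO PAIR from the named
facts and two unit-coefficient certificates.** Inputs: Thm. 1.2 (`h12`), Thm. 1.3 = Thm. 4.1 at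
`η = 1` (`h13`), Thm. 2.2 at `η` (`h22`), Thm. 4.1 at `η` (`h41`) — named facts; `p ≥ 5`, `V` good
with `a_p = 0`, `ρ_{V,p^m}` onto for all `m`; `hcertV`: SOME plus function `L_p⁺(V,T)` of the newform
has a unit coefficient at `T^{rank V(ℚ)}`; `hcertη`: EVERY branch function `L_p⁺(V,η,T)` has a unit
coefficient at `T^{rank V^{(p*)}(ℚ)}`. Proof: (RK⁺) at the pair (§1, frame discharged) ⟹ (C1_η) at the
pair by k8q-c2's `λ`-squeeze ⟹ (C1⁺_η) at the pair by k8q-c3's unconditional transport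
`etaTransportPlus`. CONDITIONAL on the displayed inputs; asserts nothing class-wide.
[cite: Kobayashi2003, Thm. 1.2 and Thm. 1.3 (p. 2), Thm. 2.2 (p. 5), Thm. 4.1 and §4 (p. 8), (3.4)/(3.6) (p. 7)]
[cite: Pollack2003, Thm. 5.6 and Prop. 6.18 (computability of the plus functions)] -/
theorem quadraticBranchPlusEtaMainConjectureAt_of_namedFacts_of_unitCoeffCertificates
    (h12 : Kobayashi2003.thm12_signedSelmerDual_finite_torsion)
    (h13 : Kobayashi2003.thm41_signedCharIdeal_divisibility)
    (h22 : Kobayashi2003.thm22_etaSignedSelmerDual_finite_torsion)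
    (h41 : Kobayashi2003.thm41_plusEtaCharIdeal_dvd)
    (hp5 : 5 ≤ p) (hgood : V.HasGoodReductionAtPrime p) (hap : V.frobeniusTrace p = 0)
    (hsurj : ∀ m : ℕ, V.HasSurjectiveModNGaloisRep (p ^ m : ℕ))
    (hcertV : ∀ {N : ℕ} [NeZero N] (f : CuspForm (Gamma0 N) 2), IsNewformOf V f →
      ∃ L : IwasawaAlgebra p, Kobayashi2003.IsSignedPAdicLFunction f p 1 L ∧
        IsUnit (PowerSeries.coeff V.mordellWeilRank L))
    (hcertη : ∀ {N : ℕ} [NeZero N] {f : CuspForm (Gamma0 N) 2}, IsNewformOf V f →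
      ∀ (ϖ : ℚ), (if Even (p / 2) then (ϖ : ℝ) * V.realPeriodRat = plusPeriod f
          else (ϖ : ℝ) * V.imaginaryPeriodRat = minusPeriod f) →
      ∀ (Lη : IwasawaAlgebra p), IsQuadraticBranchPlusLFunction f p ϖ Lη →
        IsUnit (PowerSeries.coeff (V.quadraticTwist ((-1) ^ (p / 2) * p)).mordellWeilRank Lη)) :
    QuadraticBranchPlusEtaMainConjectureAt V p := by
  have hC1 : QuadraticBranchPlusMainConjectureAt V p :=
    quadraticBranchPlusMainConjectureAt_of_katoDivisibility_of_unitCoeffCertificates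
      (plusKatoDivisibilityBranch_of_namedFacts h41 h22 h12 V p hp5 hgood hap) h12 h13 hsurj
      (fun f hf => hcertV f hf) (fun hf ϖ hϖ Lη hL => hcertη hf ϖ hϖ Lη hL)
  intro K₀ _ _ _ _ ηq hηK hη1 N _ f hp2 hgood' hap' hf ϖ hϖ Lη hL κ γ hκ hγ hγK hγc D
  exact etaTransportPlus p hp5 K₀ ηq hηK hη1 V hp2 hgood' hap' hC1 hf ϖ hϖ Lη hL κ γ hκ hγ hγK hγc D

/-- **(E⁺_η) — the content of crux 19601 — AT A TOWER-ONTO PAIR from the named facts and the two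
unit-coefficient certificates** (the lower half of the previous theorem). CONDITIONAL; asserts nothing
class-wide; closes nothing. [cite: Kobayashi2003, Thm. 1.2 and Thm. 1.3 (p. 2), Thm. 2.2 (p. 5), Thm. 4.1 and §4 (p. 8)] -/
theorem quadraticBranchPlusEtaLowerInclusionAt_of_namedFacts_of_unitCoeffCertificates
    (h12 : Kobayashi2003.thm12_signedSelmerDual_finite_torsion)
    (h13 : Kobayashi2003.thm41_signedCharIdeal_divisibility)
    (h22 : Kobayashi2003.thm22_etaSignedSelmerDual_finite_torsion)
    (h41 : Kobayashi2003.thm41_plusEtaCharIdeal_dvd)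
    (hp5 : 5 ≤ p) (hgood : V.HasGoodReductionAtPrime p) (hap : V.frobeniusTrace p = 0)
    (hsurj : ∀ m : ℕ, V.HasSurjectiveModNGaloisRep (p ^ m : ℕ))
    (hcertV : ∀ {N : ℕ} [NeZero N] (f : CuspForm (Gamma0 N) 2), IsNewformOf V f →
      ∃ L : IwasawaAlgebra p, Kobayashi2003.IsSignedPAdicLFunction f p 1 L ∧
        IsUnit (PowerSeries.coeff V.mordellWeilRank L))
    (hcertη : ∀ {N : ℕ} [NeZero N] {f : CuspForm (Gamma0 N) 2}, IsNewformOf V f →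
      ∀ (ϖ : ℚ), (if Even (p / 2) then (ϖ : ℝ) * V.realPeriodRat = plusPeriod f
          else (ϖ : ℝ) * V.imaginaryPeriodRat = minusPeriod f) →
      ∀ (Lη : IwasawaAlgebra p), IsQuadraticBranchPlusLFunction f p ϖ Lη →
        IsUnit (PowerSeries.coeff (V.quadraticTwist ((-1) ^ (p / 2) * p)).mordellWeilRank Lη)) :
    QuadraticBranchPlusEtaLowerInclusionAt V p :=
  quadraticBranchPlusEtaLowerInclusionAt_of_plusEtaMainConjectureAt
    (quadraticBranchPlusEtaMainConjectureAt_of_namedFacts_of_unitCoeffCertificates h12 h13 h22 h41 hp5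
      hgood hap hsurj hcertV hcertη)

end Certificates

/-! ## §3 Route level: crux 19601 from the facts, the certificates and its residual rows -/

/-- **Crux 19601 `PlusEtaLowerInclusion` BY NAME from the named facts, its CERTIFICATE ROWS and its
RESIDUAL ROWS displayed**: GRANTED Kobayashi's Thm. 1.2 / 1.3 / 2.2(η) / 4.1(η) (hypotheses), (E⁺_η)
holds on every onto-tower Gss2 pair that EITHER carries both unit-coefficient certificates (§2) OR
belongs to the displayed residual class `hres` (the pairs without both certificates: `p ∣` the leading
coefficient of `L_p⁺(V)` or of `L_p⁺(V,η)` — BSD-nontrivial rows —, `λ`-jumps, `μ > 0`: the OPEN core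
of the crux, where nothing is in print). CONDITIONAL; closes nothing; asserts (E⁺_η) for no specific
pair. [cite: Kobayashi2003, Thm. 1.2 / 1.3 (p. 2), Thm. 2.2 (p. 5), §4 + Thm. 4.1 (p. 8)]
[cite: Kato2004Asterisque, Conj. 12.10 (the residual rows = Kato's lower inclusion for the additive twist)] -/
theorem plusEtaLowerInclusion_of_namedFacts_of_certificateRows_of_residualRows
    (h12 : Kobayashi2003.thm12_signedSelmerDual_finite_torsion)
    (h13 : Kobayashi2003.thm41_signedCharIdeal_divisibility)
    (h22 : Kobayashi2003.thm22_etaSignedSelmerDual_finite_torsion)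
    (h41 : Kobayashi2003.thm41_plusEtaCharIdeal_dvd)
    (hres : ∀ (V : WeierstrassCurve ℚ) [V.IsElliptic] [V.IsGloballyMinimal] (p : ℕ) [Fact p.Prime],
      5 ≤ p → V.HasGoodReductionAtPrime p → V.frobeniusTrace p = 0 →
      (∀ m : ℕ, V.HasSurjectiveModNGaloisRep (p ^ m : ℕ)) →
      ¬ ((∀ {N : ℕ} [NeZero N] (f : CuspForm (Gamma0 N) 2), IsNewformOf V f →
            ∃ L : IwasawaAlgebra p, Kobayashi2003.IsSignedPAdicLFunction f p 1 L ∧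
              IsUnit (PowerSeries.coeff V.mordellWeilRank L)) ∧
         (∀ {N : ℕ} [NeZero N] {f : CuspForm (Gamma0 N) 2}, IsNewformOf V f →
            ∀ (ϖ : ℚ), (if Even (p / 2) then (ϖ : ℝ) * V.realPeriodRat = plusPeriod f
                else (ϖ : ℝ) * V.imaginaryPeriodRat = minusPeriod f) →
            ∀ (Lη : IwasawaAlgebra p), IsQuadraticBranchPlusLFunction f p ϖ Lη →
              IsUnit (PowerSeries.coeff (V.quadraticTwist ((-1) ^ (p / 2) * p)).mordellWeilRank Lη))) →
      QuadraticBranchPlusEtaLowerInclusionAt V p) :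
    PlusEtaLowerInclusion := by
  intro V _ _ p _ hp5 hgood hap hsurj
  by_cases hcert :
      (∀ {N : ℕ} [NeZero N] (f : CuspForm (Gamma0 N) 2), IsNewformOf V f →
          ∃ L : IwasawaAlgebra p, Kobayashi2003.IsSignedPAdicLFunction f p 1 L ∧
            IsUnit (PowerSeries.coeff V.mordellWeilRank L)) ∧
        (∀ {N : ℕ} [NeZero N] {f : CuspForm (Gamma0 N) 2}, IsNewformOf V f →
          ∀ (ϖ : ℚ), (if Even (p / 2) then (ϖ : ℝ) * V.realPeriodRat = plusPeriod f
              else (ϖ : ℝ) * V.imaginaryPeriodRat = minusPeriod f) →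
          ∀ (Lη : IwasawaAlgebra p), IsQuadraticBranchPlusLFunction f p ϖ Lη →
            IsUnit (PowerSeries.coeff (V.quadraticTwist ((-1) ^ (p / 2) * p)).mordellWeilRank Lη))
  · exact quadraticBranchPlusEtaLowerInclusionAt_of_namedFacts_of_unitCoeffCertificates h12 h13 h22 h41
      hp5 hgood hap hsurj (fun f hf => hcert.1 f hf) (fun hf ϖ hϖ Lη hL => hcert.2 hf ϖ hϖ Lη hL)
  · exact hres V p hp5 hgood hap hsurj hcert

end Summit.BirchSwinnertonDyer.BirchSwinnertonDyer.Theorems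

end
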